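import Mathlib
import HarnessLib

/-!
# The off-diagonal Hessian block of `per_m` at the Bedi–Suagee / Cai–Chen–Li witness has an explicit
# inverse: `R · S = 4 · 1` (row BS26-A, part C)

Topic `Literature/Computability/AlgebraicComplexity`; cell val-lit (D-0074), row BS26-A (lead-lmr RULING
2026-08-26T07:22:44Z, blueprint `HOME/lmr/BLUEPRINT-OddCharHessianBound.md` by val-lit-lit g2), PART C:
the purely combinatorial certificate. On the index set `P = {(i,j) : i ≠ j} ⊂ Fin (n+1) × Fin (n+1)`
(`BS26.OffDiag n`, special index `★ = Fin.last n`, the convention of `CCL10HessianCharP.lean`) define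
the two integer matrices of the blueprint's §7 (with `a, b, c` pairwise distinct, `≠ ★`):

* `bsR n`: `[(★,a),(a,★)] = 1, [(★,a),(a,b)] = 1, [(a,★),(★,a)] = 1, [(a,★),(b,a)] = 1, [(a,b),(★,a)] = 1,
  [(a,b),(b,★)] = 1, [(a,b),(b,a)] = −2, [(a,b),(b,c)] = 1, [(a,b),(c,a)] = 1`, all other entries `0`
  — per the blueprint §2 this is the off-diagonal block of the Hessian of `per_{n+1}` at the integer
  matrix `caiChenLiMatrix F n (−n)` (that identification is parts B/D, NOT done in this file);
* `bsS n`: `[(★,a),(★,b)] = −1, [(★,a),(a,★)] = 5−n, [(★,a),(a,b)] = 1, [(a,★),(b,★)] = −1,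
  [(a,★),(★,a)] = 5−n, [(a,★),(b,a)] = 1, [(a,b),(★,a)] = 1, [(a,b),(b,★)] = 1, [(a,b),(b,a)] = −1`,
  all other entries `0`;

and PROVE `bsR n * bsS n = 4 • 1` over every commutative ring (`BS26.bsR_mul_bsS`), hence over a field
with `2 ≠ 0`: `bsR n` is invertible and has rank `|P| = (n+1)·n` (`BS26.rank_bsR`,
`BS26.card_offDiag`). Proof (uniform in `n`, the hand form of the blueprint's 13-type case table §6):
row `(★,a)` of `R` is the indicator of `{t : t.1 = a}`, row `(a,★)` that of `{t : t.2 = a}`, row `(a,b)`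
is `[t.1 = b] + [t.2 = a] − 4·[t = (b,a)]`; and the column sums of `S` are
`Σ_{l' ≠ a} S[(a,l'), q] = 4·[q = (★,a)]`, `Σ_{k' ≠ a} S[(k',a), q] = 4·[q = (a,★)]` (`a ≠ ★`;
`BS26.colsum₁`, `BS26.colsum₂`), while `S[(b,a), q] = −[q = (a,b)] + [q = (★,b)] + [q = (a,★)]`.

Attribution: witness and elimination — K. Bedi, J. Suagee 2026 [cite: BediSuagee2026] (statement inferred
from the companion repository `hessian_of_permanent_is_full_rank_demonstration`; printed text NOT held,
acq-01251 — so no named fact is typed from it, only proved theorems); the closed forms of `R`, `S` were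
re-derived and checked numerically (`m = 3..9`) by val-lit-lit g2 (blueprint §2–§3, scripts
`HOME/lit/BS2026/bs_*.py`); Hessian method: Mignon–Ressayre 2004 §2–3, Cai–Chen–Li 2010 §2.1. Theorems
only plus the plumbing `OffDiag/rE/sE/bsR/bsS`; no named facts. Honest framing: an elementary full-rank
certificate; it proves no lower bound by itself (part D assembles `m² − m ≤ 2·dc(per_m)` for
`char ≠ 2`), and VP ≠ VNP is not proved — nothing here is progress on it.

## References

* [BediSuagee2026] K. Bedi, J. Suagee, *The Hessian of the permanent is of full rank* (title per the
  companion repository), Theory Comput. Syst. 70 (2026) art. 13, doi:10.1007/s00224-025-10253-8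
  (not held; acq-01251).
* [CaiChenLi2010] J.-Y. Cai, X. Chen, D. Li, comput. complex. 19 (2010) 37–56, §2.1 (the witness matrix).
* [MignonRessayre2004] T. Mignon, N. Ressayre, IMRN 2004:79, 4241–4253, §2–3 (the Hessian method).
-/

noncomputable section

namespace Literature.Computability.AlgebraicComplexity

namespace BS26

open Finset

variable (n : ℕ)

/-- The off-diagonal index pairs `P = {(i,j) : i ≠ j} ⊂ Fin (n+1) × Fin (n+1)` (positions of the
off-diagonal variables `x_{ij}`). Plumbing. [cite: BediSuagee2026, companion repository] -/
abbrev OffDiag : Type := {p : Fin (n + 1) × Fin (n + 1) // p.1 ≠ p.2}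

/-- `|P| = (n+1)·n`. [cite: BediSuagee2026, companion repository] -/
theorem card_offDiag : Fintype.card (OffDiag n) = (n + 1) * n := by
  rw [Fintype.card_subtype]
  have h : (Finset.univ.filter fun p : Fin (n + 1) × Fin (n + 1) => p.1 ≠ p.2) =
      (Finset.univ : Finset (Fin (n + 1))).offDiag := by
    ext p
    simp [Finset.mem_offDiag]
  rw [h, Finset.offDiag_card, Finset.card_univ, Fintype.card_fin]
  have : (n + 1) * (n + 1) = (n + 1) * n + (n + 1) := by ring
  omega

variable {n}
variable (R : Type*) [CommRing R]

/-- The entries of `R` as a function of index pairs (blueprint §7; `★ = Fin.last n`):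
row `(★,a)`: `[t.1 = a]`; row `(a,★)`: `[t.2 = a]`; row `(a,b)`: `[t.1 = b] + [t.2 = a] − 4·[t = (b,a)]`
(so `[(a,b),(b,a)] = −2`). Plumbing. [cite: BediSuagee2026, companion repository] -/
def rE (p t : Fin (n + 1) × Fin (n + 1)) : R :=
  if p.1 = Fin.last n then (if t.1 = p.2 then 1 else 0)
  else if p.2 = Fin.last n then (if t.2 = p.1 then 1 else 0)
  else (if t.1 = p.2 then 1 else 0) + (if t.2 = p.1 then 1 else 0) -
    (if t.1 = p.2 ∧ t.2 = p.1 then 4 else 0)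

/-- The entries of `S` as a function of index pairs (blueprint §7; `★ = Fin.last n`, the value
`5 − n` = the blueprint's `6 − m`). Plumbing. [cite: BediSuagee2026, companion repository] -/
def sE (t q : Fin (n + 1) × Fin (n + 1)) : R :=
  if t.1 = Fin.last n then
    (if q.1 = Fin.last n then (if q.2 = t.2 then 0 else -1)
      else if q.1 = t.2 then (if q.2 = Fin.last n then (5 : R) - n else 1) else 0)
  else if t.2 = Fin.last n then
    (if q.2 = Fin.last n then (if q.1 = t.1 then 0 else -1)
      else if q.2 = t.1 then (if q.1 = Fin.last n then (5 : R) - n else 1) else 0)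
  else
    (if q.1 = t.2 ∧ q.2 = t.1 then -1 else 0) + (if q.1 = Fin.last n ∧ q.2 = t.1 then 1 else 0) +
      (if q.1 = t.2 ∧ q.2 = Fin.last n then 1 else 0)

/-- **The matrix `R`** of the blueprint (§2/§7) on the off-diagonal pairs.
[cite: BediSuagee2026, companion repository] -/
def bsR : Matrix (OffDiag n) (OffDiag n) R := fun p t => rE R p.1 t.1

/-- **The matrix `S`** of the blueprint (§3/§7): `4·R⁻¹`. [cite: BediSuagee2026, companion repository] -/
def bsS : Matrix (OffDiag n) (OffDiag n) R := fun t q => sE R t.1 q.1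

/-! ### Sums over the off-diagonal pairs -/

/-- A sum over `P` of a function of the underlying pair, as a double sum. [folklore] -/
private theorem sum_offDiag (g : Fin (n + 1) × Fin (n + 1) → R) :
    ∑ t : OffDiag n, g t.1 = ∑ k : Fin (n + 1), ∑ l : Fin (n + 1), if k ≠ l then g (k, l) else 0 := by
  rw [← Finset.sum_subtype (Finset.univ.filter fun p : Fin (n + 1) × Fin (n + 1) => p.1 ≠ p.2)
    (by simp), Finset.sum_filter, Fintype.sum_prod_type]

/-- The number of indices other than `a` and `★`. [folklore] -/
private theorem sum_ne_ne (a : Fin (n + 1)) (ha : a ≠ Fin.last n) :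
    ∑ l' : Fin (n + 1), (if l' ≠ a ∧ l' ≠ Fin.last n then (1 : R) else 0) = (n : R) - 1 := by
  rw [Finset.sum_boole]
  have h : (Finset.univ.filter fun l' : Fin (n + 1) => l' ≠ a ∧ l' ≠ Fin.last n) =
      Finset.univ \ {a, Fin.last n} := by
    ext l'
    simp [not_or]
  have hn : 1 ≤ n := by
    rcases Nat.eq_zero_or_pos n with rfl | h
    · exfalso
      apply ha
      apply Fin.ext
      rw [Fin.val_last]
      have := a.isLt
      omega
    · exact h
  rw [h, Finset.card_sdiff_of_subset (Finset.subset_univ _), Finset.card_univ, Fintype.card_fin,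
    Finset.card_pair ha, show n + 1 - 2 = n - 1 by omega, Nat.cast_sub hn, Nat.cast_one]

/-- **First column sum of `S`:** `Σ_{l' ≠ a} S[(a,l'), q] = 4·[q = (★,a)]` for `a ≠ ★`.
[cite: BediSuagee2026, companion repository] -/
theorem colsum₁ (a : Fin (n + 1)) (ha : a ≠ Fin.last n) (q : Fin (n + 1) × Fin (n + 1))
    (hq : q.1 ≠ q.2) :
    ∑ l' : Fin (n + 1), (if a ≠ l' then sE R (a, l') q else 0) =
      if q.1 = Fin.last n ∧ q.2 = a then 4 else 0 := by
  obtain ⟨k, l⟩ := q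
  simp only at hq ⊢
  have hla : Fin.last n ≠ a := fun h => ha h.symm
  by_cases hl : l = a
  · subst hl
    by_cases hk : k = Fin.last n
    · subst hk
      -- value 4 = (5 - n) + (n - 1)
      rw [if_pos ⟨rfl, rfl⟩]
      have hpt : ∀ l' : Fin (n + 1), (if l ≠ l' then sE R (l, l') (Fin.last n, l) else 0) =
          (if l' = Fin.last n then (5 : R) - n else 0) +
            (if l' ≠ l ∧ l' ≠ Fin.last n then (1 : R) else 0) := by
        intro l'
        unfold sE
        split_ifs <;> simp_all
      rw [Finset.sum_congr rfl fun l' _ => hpt l', Finset.sum_add_distrib, Finset.sum_ite_eq',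
        if_pos (Finset.mem_univ _), sum_ne_ne R l ha]
      ring
    · rw [if_neg (fun h => hk h.1)]
      have hkl : k ≠ l := hq
      have hpt : ∀ l' : Fin (n + 1), (if l ≠ l' then sE R (l, l') (k, l) else 0) =
          (if l' = Fin.last n then (1 : R) else 0) + (if l' = k then (-1 : R) else 0) := by
        intro l'
        unfold sE
        split_ifs <;> simp_all
      rw [Finset.sum_congr rfl fun l' _ => hpt l', Finset.sum_add_distrib, Finset.sum_ite_eq',
        if_pos (Finset.mem_univ _), Finset.sum_ite_eq', if_pos (Finset.mem_univ _)]
      ring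
  · rw [if_neg (fun h => hl h.2)]
    by_cases hl' : l = Fin.last n
    · subst hl'
      have hkl : k ≠ Fin.last n := hq
      have hpt : ∀ l' : Fin (n + 1), (if a ≠ l' then sE R (a, l') (k, Fin.last n) else 0) =
          (if l' = Fin.last n then (if k = a then (0 : R) else -1) else 0) +
            (if l' = k ∧ k ≠ a then (1 : R) else 0) := by
        intro l'
        unfold sE
        split_ifs <;> simp_all
      rw [Finset.sum_congr rfl fun l' _ => hpt l', Finset.sum_add_distrib, Finset.sum_ite_eq',
        if_pos (Finset.mem_univ _)]
      by_cases hka : k = a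
      · subst hka
        simp
      · rw [if_neg hka]
        have : ∑ l' : Fin (n + 1), (if l' = k ∧ k ≠ a then (1 : R) else 0) = 1 := by
          rw [show (fun l' : Fin (n + 1) => if l' = k ∧ k ≠ a then (1 : R) else 0) =
              fun l' => if l' = k then 1 else 0 from funext fun l' => by simp [hka]]
          rw [Finset.sum_ite_eq', if_pos (Finset.mem_univ _)]
        rw [this]
        ring
    · -- `l ∉ {a, ★}`: every summand vanishes
      refine Finset.sum_eq_zero fun l' _ => ?_
      unfold sE
      split_ifs <;> simp_all

/-- **Second column sum of `S`:** `Σ_{k' ≠ a} S[(k',a), q] = 4·[q = (a,★)]` for `a ≠ ★`.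
[cite: BediSuagee2026, companion repository] -/
theorem colsum₂ (a : Fin (n + 1)) (ha : a ≠ Fin.last n) (q : Fin (n + 1) × Fin (n + 1))
    (hq : q.1 ≠ q.2) :
    ∑ k' : Fin (n + 1), (if k' ≠ a then sE R (k', a) q else 0) =
      if q.1 = a ∧ q.2 = Fin.last n then 4 else 0 := by
  obtain ⟨k, l⟩ := q
  simp only at hq ⊢
  have hla : Fin.last n ≠ a := fun h => ha h.symm
  by_cases hk : k = a
  · subst hk
    by_cases hl : l = Fin.last n
    · subst hl
      rw [if_pos ⟨rfl, rfl⟩]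
      have hpt : ∀ k' : Fin (n + 1), (if k' ≠ k then sE R (k', k) (k, Fin.last n) else 0) =
          (if k' = Fin.last n then (5 : R) - n else 0) +
            (if k' ≠ k ∧ k' ≠ Fin.last n then (1 : R) else 0) := by
        intro k'
        unfold sE
        split_ifs <;> simp_all
      rw [Finset.sum_congr rfl fun k' _ => hpt k', Finset.sum_add_distrib, Finset.sum_ite_eq',
        if_pos (Finset.mem_univ _), sum_ne_ne R k ha]
      ring
    · rw [if_neg (fun h => hl h.2)]
      have hkl : k ≠ l := hq
      have hpt : ∀ k' : Fin (n + 1), (if k' ≠ k then sE R (k', k) (k, l) else 0) =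
          (if k' = Fin.last n then (1 : R) else 0) + (if k' = l then (-1 : R) else 0) := by
        intro k'
        unfold sE
        split_ifs <;> simp_all
      rw [Finset.sum_congr rfl fun k' _ => hpt k', Finset.sum_add_distrib, Finset.sum_ite_eq',
        if_pos (Finset.mem_univ _), Finset.sum_ite_eq', if_pos (Finset.mem_univ _)]
      ring
  · rw [if_neg (fun h => hk h.1)]
    by_cases hk' : k = Fin.last n
    · subst hk'
      have hkl : Fin.last n ≠ l := hq
      have hpt : ∀ k' : Fin (n + 1), (if k' ≠ a then sE R (k', a) (Fin.last n, l) else 0) =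
          (if k' = Fin.last n then (if l = a then (0 : R) else -1) else 0) +
            (if k' = l ∧ l ≠ a then (1 : R) else 0) := by
        intro k'
        unfold sE
        split_ifs <;> simp_all
      rw [Finset.sum_congr rfl fun k' _ => hpt k', Finset.sum_add_distrib, Finset.sum_ite_eq',
        if_pos (Finset.mem_univ _)]
      by_cases hla' : l = a
      · subst hla'
        simp
      · rw [if_neg hla']
        have : ∑ k' : Fin (n + 1), (if k' = l ∧ l ≠ a then (1 : R) else 0) = 1 := by
          rw [show (fun k' : Fin (n + 1) => if k' = l ∧ l ≠ a then (1 : R) else 0) =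
              fun k' => if k' = l then 1 else 0 from funext fun k' => by simp [hla']]
          rw [Finset.sum_ite_eq', if_pos (Finset.mem_univ _)]
        rw [this]
        ring
    · refine Finset.sum_eq_zero fun k' _ => ?_
      unfold sE
      split_ifs <;> simp_all

/-! ### `R · S = 4 · 1` -/

/-- **The certificate: `bsR n * bsS n = 4 • 1` over every commutative ring** (blueprint §3/§6: hence
`det R = ± 4^{…}` and `R` is invertible as soon as `2` is). [cite: BediSuagee2026, companion repository] -/
theorem bsR_mul_bsS : bsR (n := n) R * bsS R = (4 : R) • (1 : Matrix (OffDiag n) (OffDiag n) R) := by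
  ext p q
  obtain ⟨⟨i, j⟩, hij⟩ := p
  obtain ⟨⟨k, l⟩, hkl⟩ := q
  simp only [Ne, Matrix.mul_apply, bsR, bsS, Matrix.smul_apply, Matrix.one_apply, smul_eq_mul,
    mul_ite, mul_one, mul_zero, Subtype.mk.injEq, Prod.mk.injEq]
  simp only at hij hkl
  -- the three row types
  by_cases hi : i = Fin.last n
  · -- row `(★, a)`, `a = j ≠ ★`
    subst hi
    have hj : j ≠ Fin.last n := fun h => hij h.symm
    have hrow : ∀ t : OffDiag n, rE R (Fin.last n, j) t.1 * sE R t.1 (k, l) =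
        (if t.1.1 = j then (1 : R) else 0) * sE R t.1 (k, l) := fun t => by simp [rE]
    rw [Finset.sum_congr rfl fun t _ => hrow t,
      sum_offDiag R fun t => (if t.1 = j then (1 : R) else 0) * sE R t (k, l),
      Finset.sum_eq_single j (fun k' _ hk' => Finset.sum_eq_zero fun l' _ => by simp [hk'])
        (fun h => absurd (Finset.mem_univ j) h)]
    simp only [if_true, one_mul]
    rw [colsum₁ R j hj (k, l) hkl]
    by_cases h : k = Fin.last n ∧ l = j
    · rw [if_pos h, if_pos (show Fin.last n = k ∧ j = l from ⟨h.1.symm, h.2.symm⟩)]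
    · rw [if_neg h, if_neg (show ¬(Fin.last n = k ∧ j = l) from
        fun h' => h ⟨h'.1.symm, h'.2.symm⟩)]
  · by_cases hj : j = Fin.last n
    · -- row `(a, ★)`, `a = i ≠ ★`
      subst hj
      have hrow : ∀ t : OffDiag n, rE R (i, Fin.last n) t.1 * sE R t.1 (k, l) =
          (if t.1.2 = i then (1 : R) else 0) * sE R t.1 (k, l) := fun t => by simp [rE, hi]
      rw [Finset.sum_congr rfl fun t _ => hrow t,
        sum_offDiag R fun t => (if t.2 = i then (1 : R) else 0) * sE R t (k, l),
        Finset.sum_comm,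
        Finset.sum_eq_single i (fun l' _ hl' => Finset.sum_eq_zero fun k' _ => by simp [hl'])
          (fun h => absurd (Finset.mem_univ i) h)]
      simp only [if_true, one_mul]
      have : ∑ k' : Fin (n + 1), (if ¬k' = i then sE R (k', i) (k, l) else 0) =
          ∑ k' : Fin (n + 1), (if k' ≠ i then sE R (k', i) (k, l) else 0) := rfl
      rw [this, colsum₂ R i hi (k, l) hkl]
      by_cases h : k = i ∧ l = Fin.last n
      · rw [if_pos h, if_pos (show i = k ∧ Fin.last n = l from ⟨h.1.symm, h.2.symm⟩)]
      · rw [if_neg h, if_neg (show ¬(i = k ∧ Fin.last n = l) from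
          fun h' => h ⟨h'.1.symm, h'.2.symm⟩)]
    · -- row `(a, b)`, `a = i`, `b = j`, both `≠ ★`, `a ≠ b`
      have hrow : ∀ t : OffDiag n, rE R (i, j) t.1 * sE R t.1 (k, l) =
          (if t.1.1 = j then (1 : R) else 0) * sE R t.1 (k, l) +
            (if t.1.2 = i then (1 : R) else 0) * sE R t.1 (k, l) -
            (if t.1.1 = j ∧ t.1.2 = i then (4 : R) else 0) * sE R t.1 (k, l) := fun t => by
        simp only [rE, hi, hj, if_false]
        ring
      rw [Finset.sum_congr rfl fun t _ => hrow t, Finset.sum_sub_distrib, Finset.sum_add_distrib]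
      -- first sum: column sum 1 at `b = j`
      rw [sum_offDiag R fun t => (if t.1 = j then (1 : R) else 0) * sE R t (k, l),
        Finset.sum_eq_single j (fun k' _ hk' => Finset.sum_eq_zero fun l' _ => by simp [hk'])
          (fun h => absurd (Finset.mem_univ j) h)]
      simp only [if_true, one_mul]
      rw [colsum₁ R j hj (k, l) hkl]
      -- second sum: column sum 2 at `a = i`
      rw [sum_offDiag R fun t => (if t.2 = i then (1 : R) else 0) * sE R t (k, l),
        Finset.sum_comm,
        Finset.sum_eq_single i (fun l' _ hl' => Finset.sum_eq_zero fun k' _ => by simp [hl'])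
          (fun h => absurd (Finset.mem_univ i) h)]
      simp only [if_true, one_mul]
      have : ∑ k' : Fin (n + 1), (if ¬k' = i then sE R (k', i) (k, l) else 0) =
          ∑ k' : Fin (n + 1), (if k' ≠ i then sE R (k', i) (k, l) else 0) := rfl
      rw [this, colsum₂ R i hi (k, l) hkl]
      -- third sum: the single term `t = (j, i)`
      have hji : j ≠ i := fun h => hij h.symm
      rw [Finset.sum_eq_single ⟨(j, i), hji⟩ (fun t _ ht => by
          have : ¬(t.1.1 = j ∧ t.1.2 = i) := fun h =>
            ht (Subtype.ext (Prod.ext h.1 h.2))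
          simp [this]) (fun h => absurd (Finset.mem_univ _) h)]
      simp only [and_self, if_true]
      -- evaluate `S[(b,a), (k,l)]`
      have hS : sE R (j, i) (k, l) = (if k = i ∧ l = j then (-1 : R) else 0) +
          (if k = Fin.last n ∧ l = j then (1 : R) else 0) +
          (if k = i ∧ l = Fin.last n then (1 : R) else 0) := by
        simp [sE, hi, hj]
      rw [hS]
      have key : (if i = k ∧ j = l then (4 : R) else 0) = if k = i ∧ l = j then 4 else 0 := by
        by_cases h : k = i ∧ l = j
        · rw [if_pos h, if_pos (show i = k ∧ j = l from ⟨h.1.symm, h.2.symm⟩)]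
        · rw [if_neg h, if_neg (show ¬(i = k ∧ j = l) from fun h' => h ⟨h'.1.symm, h'.2.symm⟩)]
      rw [key]
      by_cases e1 : k = i <;> by_cases e2 : l = j <;> by_cases e3 : k = Fin.last n <;>
        by_cases e4 : l = Fin.last n <;> simp_all

/-! ### Consequences over a field with `2 ≠ 0` -/

/-- Over a field with `2 ≠ 0`, `R` is invertible. [cite: BediSuagee2026, companion repository] -/
theorem isUnit_bsR (F : Type*) [Field F] (h2 : (2 : F) ≠ 0) : IsUnit (bsR (n := n) F) := by
  have h4 : (4 : F) ≠ 0 := by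
    have : (4 : F) = 2 * 2 := by norm_num
    rw [this]
    exact mul_ne_zero h2 h2
  have hmul : bsR (n := n) F * ((4 : F)⁻¹ • bsS F) = 1 := by
    rw [Matrix.mul_smul, bsR_mul_bsS, smul_smul, inv_mul_cancel₀ h4, one_smul]
  exact ⟨⟨bsR F, (4 : F)⁻¹ • bsS F, hmul, mul_eq_one_comm.1 hmul⟩, rfl⟩

/-- **Full rank:** over a field with `2 ≠ 0`, `rank R = |P| = (n+1)·n`.
[cite: BediSuagee2026, companion repository] -/
theorem rank_bsR (F : Type*) [Field F] (h2 : (2 : F) ≠ 0) :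
    (bsR (n := n) F).rank = (n + 1) * n := by
  rw [Matrix.rank_of_isUnit _ (isUnit_bsR F h2), card_offDiag]

end BS26

end Literature.Computability.AlgebraicComplexity

end
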